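import Summits.QuantumFields.YangMills.Theorems.ColdStartUniversalityLatticeLangevinGeneratorSymmetric
import HarnessLib

/-!
# Route `ColdStartUniversality` (fixed-cut-off package): the VARIATIONAL LOWER BOUND on stationary autocorrelations of the
# reversible SZZ dynamics — `⟨F, P_t F⟩_μ ≥ ‖F‖²_μ · exp(t ⟨F, 𝓛F⟩_μ / ‖F‖²_μ)` («a slow observable decorrelates slowly»)

Helper file (seat `ym-line-csu-p1`, g15).  For the SU(2) lattice Langevin dynamics at any coupling `β'`, reversible with
respect to the Wilson measure `μ = μ_{β'}` (`integral_mul_transition_symm_su2`), and a smooth cylinder observable `F = f∘coords`: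

* `sq_integral_mul_le_integral_sq_mul` — Cauchy–Schwarz for bounded measurable functions against a finite measure;
* `sq_integral_mul_transition_le` — `⟨F, P_{s+t} F⟩² ≤ ⟨F, P_{2s} F⟩ ⟨F, P_{2t} F⟩` (Chapman–Kolmogorov + symmetry + CS):
  `t ↦ ⟨F, P_t F⟩_μ` is LOG-CONVEX at dyadic midpoints;
* `integral_mul_transition_ge_pow` — hence `⟨F, P_t F⟩ ≥ ‖F‖² (⟨F, P_{t/2^k} F⟩/‖F‖²)^{2^k}` for every `k`;
* ★ `integral_sq_mul_exp_le_integral_mul_transition` — letting `k → ∞` with the Dirichlet form of the semigroup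
  (`tendsto_dirichletForm_semigroup`: `τ⁻¹(⟨F,P_τF⟩ - ‖F‖²) → ⟨F, 𝓛F⟩ = -𝓔(F)`) and `(1 + x_n)^n → e^{lim n x_n}`:
  `‖F‖²_μ · exp(t ⟨F,𝓛F⟩_μ / ‖F‖²_μ) ≤ ⟨F, P_t F⟩_μ` for all `t ≥ 0`.

Reading: the stationary autocorrelation of `F` cannot decay faster than `exp(-t/τ_F)` with `τ_F = ‖F‖²_μ/𝓔(F)` (apply to
mean-zero `F`): the RELAXATION TIME of the reversible dynamics is at least `sup_F Var_μ(F)/𝓔(F)` — the rigorous form of the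
route's kill-shape «a slow (small-Dirichlet-energy) centre-neutral observable forces slow relaxation», at each fixed cut-off.
THEOREMS ONLY, no definition, no sorry.  RECORD-rung R3 plumbing; not the K-uniform crux; the Yang–Mills mass gap is NOT proved.
-/

set_option autoImplicit false

noncomputable section

namespace Summit.QuantumFields.YangMills.Theorems.ColdStartUniversality

open MeasureTheory ProbabilityTheory Finset Filter Set Topology
open scoped BigOperators NNReal ENNReal
open Literature.Probability.Process Literature.MathematicalPhysics.QuantumFieldTheory
open Literature.MathematicalPhysics.QuantumLattice (fundamentalRep fundamentalLatticeRep continuous_fundamentalRep)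

variable {L : ℕ} [NeZero L]

/-- **Cauchy–Schwarz** for bounded measurable real functions against a finite measure:
`(∫ A B dν)² ≤ (∫ A² dν)(∫ B² dν)` (the quadratic `λ ↦ ∫ (A - λ B)² ≥ 0`). [folklore] -/
theorem sq_integral_mul_le_integral_sq_mul {Y : Type*} [MeasurableSpace Y] (ν : Measure Y) [IsFiniteMeasure ν]
    {A B : Y → ℝ} (hAm : Measurable A) (hBm : Measurable B) {CA CB : ℝ} (hA : ∀ y, |A y| ≤ CA) (hB : ∀ y, |B y| ≤ CB) :
    (∫ y, A y * B y ∂ν) ^ 2 ≤ (∫ y, (A y) ^ 2 ∂ν) * ∫ y, (B y) ^ 2 ∂ν := by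
  -- integrability of the bounded measurable products
  have hint : ∀ {u : Y → ℝ} {C : ℝ}, Measurable u → (∀ y, |u y| ≤ C) → Integrable u ν := fun hu hC =>
    (integrable_const _).mono' hu.aestronglyMeasurable (ae_of_all _ fun y => by rw [Real.norm_eq_abs]; exact hC y)
  have hAB : Integrable (fun y => A y * B y) ν :=
    hint (hAm.mul hBm) (C := CA * CB) fun y => by
      rw [abs_mul]; exact mul_le_mul (hA y) (hB y) (abs_nonneg _) ((abs_nonneg _).trans (hA y))
  have hA2 : Integrable (fun y => (A y) ^ 2) ν :=
    hint (hAm.pow_const 2) (C := CA ^ 2) fun y => by rw [abs_pow]; exact pow_le_pow_left₀ (abs_nonneg _) (hA y) 2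
  have hB2 : Integrable (fun y => (B y) ^ 2) ν :=
    hint (hBm.pow_const 2) (C := CB ^ 2) fun y => by rw [abs_pow]; exact pow_le_pow_left₀ (abs_nonneg _) (hB y) 2
  set a : ℝ := ∫ y, (A y) ^ 2 ∂ν with ha
  set b : ℝ := ∫ y, (B y) ^ 2 ∂ν with hb
  set c : ℝ := ∫ y, A y * B y ∂ν with hc
  -- the nonnegative quadratic
  have hquad : ∀ l : ℝ, 0 ≤ a - 2 * l * c + l ^ 2 * b := by
    intro l
    have h0 : 0 ≤ ∫ y, (A y - l * B y) ^ 2 ∂ν := integral_nonneg fun y => sq_nonneg _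
    have hexp : ∫ y, (A y - l * B y) ^ 2 ∂ν = a - 2 * l * c + l ^ 2 * b := by
      have h1 : (fun y => (A y - l * B y) ^ 2) = fun y => (A y) ^ 2 - (2 * l) * (A y * B y) + l ^ 2 * (B y) ^ 2 := by
        funext y; ring
      have i1 : Integrable (fun y => (A y) ^ 2 - (2 * l) * (A y * B y)) ν := hA2.sub (hAB.const_mul _)
      have i2 : Integrable (fun y => l ^ 2 * (B y) ^ 2) ν := hB2.const_mul _
      have i3 : Integrable (fun y => (2 * l) * (A y * B y)) ν := hAB.const_mul _
      rw [h1, integral_add i1 i2, integral_sub hA2 i3, integral_const_mul, integral_const_mul]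
      try ring
    linarith
  have hb0 : 0 ≤ b := integral_nonneg fun y => sq_nonneg _
  rcases hb0.lt_or_eq with hbpos | hbzero
  · have h := hquad (c / b)
    have e : a - 2 * (c / b) * c + (c / b) ^ 2 * b = a - c ^ 2 / b := by
      field_simp
      ring
    rw [e] at h
    have h2 : c ^ 2 / b ≤ a := by linarith
    rw [div_le_iff₀ hbpos] at h2
    linarith
  · -- `b = 0` forces `c = 0`
    have hc0 : c = 0 := by
      by_contra hcne
      have h := hquad ((a + 1) / (2 * c))
      have e : 2 * ((a + 1) / (2 * c)) * c = a + 1 := by field_simp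
      rw [← hbzero, mul_zero, add_zero, e] at h
      linarith
    rw [hc0, ← hbzero]
    simp

/-- **Log-convexity of stationary autocorrelations (dyadic Cauchy–Schwarz)**: for continuous `F` and lattice times `s, t`,
`(∫ F · κ_{s+t} F dμ_{β'})² ≤ (∫ F · κ_{s+s} F dμ_{β'}) (∫ F · κ_{t+t} F dμ_{β'})` — Chapman–Kolmogorov, reversibility
(`∫ F κ_s(κ_t F) dμ = ∫ (κ_t F)(κ_s F) dμ`) and Cauchy–Schwarz, with `∫ (κ_s F)² dμ = ∫ F κ_{2s} F dμ`.
[cite: ShenZhuZhu2022, §3 (p. 13)] -/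
theorem sq_integral_mul_transition_le (L : ℕ) [NeZero L] (β' : ℝ)
    (κ : ℝ≥0 → Kernel (GaugeConfig 3 L (Matrix.specialUnitaryGroup (Fin 2) ℂ))
      (GaugeConfig 3 L (Matrix.specialUnitaryGroup (Fin 2) ℂ))) [∀ t, IsMarkovKernel (κ t)]
    (hreal : ∀ (t : ℝ≥0) (x : GaugeConfig 3 L (Matrix.specialUnitaryGroup (Fin 2) ℂ))
        (Ω : Type) [MeasurableSpace Ω] (P : Measure Ω) [IsProbabilityMeasure P]
        (W : ℝ≥0 → Ω → (Edge 3 L × NoiseIdx 2 → ℝ)) (hW : IsFlatBrownian W P)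
        (U : ℝ≥0 → Ω → GaugeConfig 3 L (Matrix.specialUnitaryGroup (Fin 2) ℂ)),
        (∀ ω, U 0 ω = x) →
        (latticeLangevinDynamics (fundamentalLatticeRep 2) β').IsSolution (fundamentalRep (Fin 2))
          hW.natFiltration P W U →
        κ t x = P.map (U t))
    (s t : ℝ≥0) {F : GaugeConfig 3 L (Matrix.specialUnitaryGroup (Fin 2) ℂ) → ℝ} (hF : Continuous F) :
    (∫ x, F x * (∫ y, F y ∂(κ (s + t) x)) ∂(wilsonMeasure (d := 3) (L := L) (fundamentalRep (Fin 2)) β')) ^ 2 ≤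
      (∫ x, F x * (∫ y, F y ∂(κ (s + s) x)) ∂(wilsonMeasure (d := 3) (L := L) (fundamentalRep (Fin 2)) β')) *
        ∫ x, F x * (∫ y, F y ∂(κ (t + t) x)) ∂(wilsonMeasure (d := 3) (L := L) (fundamentalRep (Fin 2)) β') := by
  classical
  haveI := secondCountableTopology_su2
  haveI := borelSpace_config L
  set μ : Measure (GaugeConfig 3 L (Matrix.specialUnitaryGroup (Fin 2) ℂ)) :=
    wilsonMeasure (d := 3) (L := L) (fundamentalRep (Fin 2)) β' with hμ
  haveI : IsProbabilityMeasure μ :=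
    isProbabilityMeasure_wilsonMeasure (d := 3) (L := L) (fundamentalRep (Fin 2)) (continuous_fundamentalRep (Fin 2)) β'
  obtain ⟨M, hM0, hM⟩ := exists_abs_le_of_continuous hF
  have hFi : ∀ (ν : Measure (GaugeConfig 3 L (Matrix.specialUnitaryGroup (Fin 2) ℂ))) [IsProbabilityMeasure ν],
      Integrable F ν := fun ν _ =>
    Integrable.of_bound hF.aestronglyMeasurable M (Eventually.of_forall fun z => by rw [Real.norm_eq_abs]; exact hM z)
  -- the two continuous observables `κ_s F`, `κ_t F`
  have hAs : Continuous fun y => ∫ z, F z ∂(κ s y) := continuous_integral_transitionKernel L β' κ hreal s hF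
  have hAt : Continuous fun y => ∫ z, F z ∂(κ t y) := continuous_integral_transitionKernel L β' κ hreal t hF
  have hbs : ∀ y, |∫ z, F z ∂(κ s y)| ≤ M := fun y => abs_integral_le_of_abs_le_of_isProbabilityMeasure hM
  have hbt : ∀ y, |∫ z, F z ∂(κ t y)| ≤ M := fun y => abs_integral_le_of_abs_le_of_isProbabilityMeasure hM
  -- Chapman–Kolmogorov and symmetry: `∫ F κ_{s+t} F dμ = ∫ (κ_t F)(κ_s F) dμ`
  have hCK : κ (s + t) = κ t ∘ₖ κ s := chapmanKolmogorov_szz β' κ hreal s t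
  have e1 : ∀ x, ∫ y, F y ∂(κ (s + t) x) = ∫ y, (∫ z, F z ∂(κ t y)) ∂(κ s x) := by
    intro x
    haveI : IsProbabilityMeasure ((κ t ∘ₖ κ s) x) := by rw [← hCK]; infer_instance
    rw [hCK]
    exact Kernel.integral_comp (hFi _)
  have e2 : ∫ x, F x * (∫ y, F y ∂(κ (s + t) x)) ∂μ = ∫ x, (∫ z, F z ∂(κ t x)) * (∫ y, F y ∂(κ s x)) ∂μ := by
    simp_rw [e1]
    exact integral_mul_transition_symm_su2 L β' κ hreal s hF hAt
  rw [e2]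
  have hCS := sq_integral_mul_le_integral_sq_mul μ hAt.measurable hAs.measurable hbt hbs
  have hs2 : ∫ x, F x * (∫ y, F y ∂(κ (s + s) x)) ∂μ = ∫ x, (∫ y, F y ∂(κ s x)) ^ 2 ∂μ :=
    integral_mul_transition_self_eq_sq L β' κ hreal s hF
  have ht2 : ∫ x, F x * (∫ y, F y ∂(κ (t + t) x)) ∂μ = ∫ x, (∫ y, F y ∂(κ t x)) ^ 2 ∂μ :=
    integral_mul_transition_self_eq_sq L β' κ hreal t hF
  calc (∫ x, (∫ z, F z ∂(κ t x)) * (∫ y, F y ∂(κ s x)) ∂μ) ^ 2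
      ≤ (∫ x, (∫ z, F z ∂(κ t x)) ^ 2 ∂μ) * ∫ x, (∫ y, F y ∂(κ s x)) ^ 2 ∂μ := hCS
    _ = (∫ x, F x * (∫ y, F y ∂(κ (s + s) x)) ∂μ) * ∫ x, F x * (∫ y, F y ∂(κ (t + t) x)) ∂μ := by
        rw [hs2, ht2, mul_comm]

/-- **Dyadic iteration**: with `φ(u) = ∫ F · κ_u F dμ_{β'}` and `φ₀ = ∫ F² dμ_{β'} > 0`,
`φ₀ · (φ(u/2^k)/φ₀)^{2^k} ≤ φ(u)` for every `k` (repeated midpoint Cauchy–Schwarz `φ(v/2)² ≤ φ(v) φ₀`). [folklore] -/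
theorem integral_mul_transition_ge_pow (L : ℕ) [NeZero L] (β' : ℝ)
    (κ : ℝ≥0 → Kernel (GaugeConfig 3 L (Matrix.specialUnitaryGroup (Fin 2) ℂ))
      (GaugeConfig 3 L (Matrix.specialUnitaryGroup (Fin 2) ℂ))) [∀ t, IsMarkovKernel (κ t)]
    (hreal : ∀ (t : ℝ≥0) (x : GaugeConfig 3 L (Matrix.specialUnitaryGroup (Fin 2) ℂ))
        (Ω : Type) [MeasurableSpace Ω] (P : Measure Ω) [IsProbabilityMeasure P]
        (W : ℝ≥0 → Ω → (Edge 3 L × NoiseIdx 2 → ℝ)) (hW : IsFlatBrownian W P)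
        (U : ℝ≥0 → Ω → GaugeConfig 3 L (Matrix.specialUnitaryGroup (Fin 2) ℂ)),
        (∀ ω, U 0 ω = x) →
        (latticeLangevinDynamics (fundamentalLatticeRep 2) β').IsSolution (fundamentalRep (Fin 2))
          hW.natFiltration P W U →
        κ t x = P.map (U t))
    {F : GaugeConfig 3 L (Matrix.specialUnitaryGroup (Fin 2) ℂ) → ℝ} (hF : Continuous F)
    (hF0 : 0 < ∫ x, F x * F x ∂(wilsonMeasure (d := 3) (L := L) (fundamentalRep (Fin 2)) β')) (k : ℕ) (u : ℝ≥0) :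
    (∫ x, F x * F x ∂(wilsonMeasure (d := 3) (L := L) (fundamentalRep (Fin 2)) β')) *
        ((∫ x, F x * (∫ y, F y ∂(κ (u / 2 ^ k) x)) ∂(wilsonMeasure (d := 3) (L := L) (fundamentalRep (Fin 2)) β')) /
          ∫ x, F x * F x ∂(wilsonMeasure (d := 3) (L := L) (fundamentalRep (Fin 2)) β')) ^ (2 ^ k) ≤
      ∫ x, F x * (∫ y, F y ∂(κ u x)) ∂(wilsonMeasure (d := 3) (L := L) (fundamentalRep (Fin 2)) β') := by
  classical
  haveI := secondCountableTopology_su2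
  haveI := borelSpace_config L
  set μ : Measure (GaugeConfig 3 L (Matrix.specialUnitaryGroup (Fin 2) ℂ)) :=
    wilsonMeasure (d := 3) (L := L) (fundamentalRep (Fin 2)) β' with hμ
  set φ : ℝ≥0 → ℝ := fun v => ∫ x, F x * (∫ y, F y ∂(κ v x)) ∂μ with hφ
  set φ₀ : ℝ := ∫ x, F x * F x ∂μ with hφ₀
  -- `κ_0 = δ`, so `φ 0 = φ₀`
  have hκ0 : ∀ x, κ 0 x = Measure.dirac x := by
    intro x
    haveI := isProbabilityMeasure_piWiener (Edge 3 L × NoiseIdx 2)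
    have hWc := isFlatBrownian_piWiener 3 L (NoiseIdx 2)
    obtain ⟨U, hU0, hU⟩ := solution_from_start hWc β' x
    rw [hreal 0 x _ _ _ hWc U hU0 hU]
    have hU0' : U 0 = fun _ => x := funext hU0
    rw [hU0', Measure.map_const, measure_univ, one_smul]
  have hφ0 : φ 0 = φ₀ := integral_congr_ae (Eventually.of_forall fun x => by
    show F x * (∫ y, F y ∂(κ 0 x)) = F x * F x
    rw [hκ0 x, integral_dirac])
  -- nonnegativity and the midpoint inequality
  have hpos : ∀ v, 0 ≤ φ v := fun v => integral_mul_transition_self_nonneg L β' κ hreal v hF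
  have hmid : ∀ v : ℝ≥0, φ (v / 2) ^ 2 ≤ φ v * φ₀ := by
    intro v
    have h := sq_integral_mul_transition_le L β' κ hreal (v / 2) 0 hF
    simp only [add_zero, add_halves] at h
    rw [← hφ0]
    exact h
  -- the iteration
  have hiter : ∀ k : ℕ, ∀ v : ℝ≥0, φ₀ * (φ (v / 2 ^ k) / φ₀) ^ (2 ^ k) ≤ φ v := by
    intro k
    induction k with
    | zero =>
      intro v
      simp only [pow_zero, div_one, pow_one]
      exact le_of_eq (by field_simp)
    | succ k ih =>
      intro v
      have hr : (φ (v / 2 ^ (k + 1)) / φ₀) ^ 2 ≤ φ (v / 2 ^ k) / φ₀ := by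
        have hm := hmid (v / 2 ^ k)
        have hv : v / 2 ^ k / 2 = v / 2 ^ (k + 1) := by rw [div_div, pow_succ]
        rw [hv] at hm
        rw [div_pow, div_le_div_iff₀ (pow_pos hF0 2) hF0]
        nlinarith [hpos (v / 2 ^ k)]
      have hnn : 0 ≤ (φ (v / 2 ^ (k + 1)) / φ₀) ^ 2 := sq_nonneg _
      have hpow := pow_le_pow_left₀ hnn hr (2 ^ k)
      rw [← pow_mul, show 2 * 2 ^ k = 2 ^ (k + 1) by rw [pow_succ, mul_comm]] at hpow
      calc φ₀ * (φ (v / 2 ^ (k + 1)) / φ₀) ^ 2 ^ (k + 1) ≤ φ₀ * (φ (v / 2 ^ k) / φ₀) ^ 2 ^ k :=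
            mul_le_mul_of_nonneg_left hpow hF0.le
        _ ≤ φ v := ih v
  exact hiter k u

/-- ★ **Variational lower bound on stationary autocorrelations**: for a `C³` compactly supported `f` of the real link
coordinates, `F = f∘coords` with `‖F‖²_μ = ∫ F² dμ_{β'} > 0`, every realising kernel family and every lattice time `t`,
`‖F‖²_μ · exp(t · ⟨F, 𝓛F⟩_μ / ‖F‖²_μ) ≤ ∫ F · κ_t F dμ_{β'}` — with `⟨F, 𝓛F⟩_μ = -𝓔(F) ≤ 0`: the autocorrelation of `F` decays
no faster than `exp(-t 𝓔(F)/‖F‖²)`; for mean-zero `F` the relaxation time is at least `Var_μ(F)/𝓔(F)`.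
[cite: ShenZhuZhu2022, §3 (Dirichlet form 𝓔^L and its semigroup, p. 13)] -/
theorem integral_sq_mul_exp_le_integral_mul_transition (L : ℕ) [NeZero L] (β' : ℝ)
    (κ : ℝ≥0 → Kernel (GaugeConfig 3 L (Matrix.specialUnitaryGroup (Fin 2) ℂ))
      (GaugeConfig 3 L (Matrix.specialUnitaryGroup (Fin 2) ℂ))) [∀ t, IsMarkovKernel (κ t)]
    (hreal : ∀ (t : ℝ≥0) (x : GaugeConfig 3 L (Matrix.specialUnitaryGroup (Fin 2) ℂ))
        (Ω : Type) [MeasurableSpace Ω] (P : Measure Ω) [IsProbabilityMeasure P]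
        (W : ℝ≥0 → Ω → (Edge 3 L × NoiseIdx 2 → ℝ)) (hW : IsFlatBrownian W P)
        (U : ℝ≥0 → Ω → GaugeConfig 3 L (Matrix.specialUnitaryGroup (Fin 2) ℂ)),
        (∀ ω, U 0 ω = x) →
        (latticeLangevinDynamics (fundamentalLatticeRep 2) β').IsSolution (fundamentalRep (Fin 2))
          hW.natFiltration P W U →
        κ t x = P.map (U t))
    {f : (Edge 3 L × Fin 2 × Fin 2 × Bool → ℝ) → ℝ} (hf : ContDiff ℝ 3 f) (hfc : HasCompactSupport f)
    (hF0 : 0 < ∫ V, f (fun q : Edge 3 L × Fin 2 × Fin 2 × Bool => (fun z : ℂ => if q.2.2.2 then z.im else z.re)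
        ((fundamentalRep (Fin 2) (V q.1) : Matrix (Fin 2) (Fin 2) ℂ) q.2.1 q.2.2.1)) *
      f (fun q : Edge 3 L × Fin 2 × Fin 2 × Bool => (fun z : ℂ => if q.2.2.2 then z.im else z.re)
        ((fundamentalRep (Fin 2) (V q.1) : Matrix (Fin 2) (Fin 2) ℂ) q.2.1 q.2.2.1))
      ∂(wilsonMeasure (d := 3) (L := L) (fundamentalRep (Fin 2)) β')) (t : ℝ≥0) :
    let coords : GaugeConfig 3 L (Matrix.specialUnitaryGroup (Fin 2) ℂ) → (Edge 3 L × Fin 2 × Fin 2 × Bool → ℝ) :=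
      fun V q => (fun z : ℂ => if q.2.2.2 then z.im else z.re)
        ((fundamentalRep (Fin 2) (V q.1) : Matrix (Fin 2) (Fin 2) ℂ) q.2.1 q.2.2.1)
    let gen : GaugeConfig 3 L (Matrix.specialUnitaryGroup (Fin 2) ℂ) → ℝ := fun V =>
      (∑ i : Edge 3 L × Fin 2 × Fin 2 × Bool, fderiv ℝ f (coords V) (Pi.single i 1) *
          (fun z : ℂ => if i.2.2.2 then z.im else z.re)
            ((latticeLangevinDynamics (fundamentalLatticeRep 2) β').drift
              (matrixConfig (fundamentalRep (Fin 2)) V) i.1 i.2.1 i.2.2.1) +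
      1 / 2 * ∑ i : Edge 3 L × Fin 2 × Fin 2 × Bool, ∑ j : Edge 3 L × Fin 2 × Fin 2 × Bool,
        fderiv ℝ (fun z => fderiv ℝ f z (Pi.single i 1)) (coords V) (Pi.single j 1) *
          ∑ n : Edge 3 L × NoiseIdx 2,
            (if n.1 = i.1 then (fun z : ℂ => if i.2.2.2 then z.im else z.re)
              ((latticeLangevinDynamics (fundamentalLatticeRep 2) β').noise
                (matrixConfig (fundamentalRep (Fin 2)) V) i.1 n.2 i.2.1 i.2.2.1) else 0) *
            (if n.1 = j.1 then (fun z : ℂ => if j.2.2.2 then z.im else z.re)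
              ((latticeLangevinDynamics (fundamentalLatticeRep 2) β').noise
                (matrixConfig (fundamentalRep (Fin 2)) V) j.1 n.2 j.2.1 j.2.2.1) else 0))
    let F' : GaugeConfig 3 L (Matrix.specialUnitaryGroup (Fin 2) ℂ) → ℝ := fun V => f (coords V)
    (∫ V, F' V * F' V ∂(wilsonMeasure (d := 3) (L := L) (fundamentalRep (Fin 2)) β')) *
        Real.exp ((t : ℝ) * (∫ V, F' V * gen V ∂(wilsonMeasure (d := 3) (L := L) (fundamentalRep (Fin 2)) β')) /
          ∫ V, F' V * F' V ∂(wilsonMeasure (d := 3) (L := L) (fundamentalRep (Fin 2)) β')) ≤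
      ∫ V, F' V * (∫ y, F' y ∂(κ t V)) ∂(wilsonMeasure (d := 3) (L := L) (fundamentalRep (Fin 2)) β') := by
  intro coords gen F'
  classical
  haveI := secondCountableTopology_su2
  haveI := borelSpace_config L
  set μ : Measure (GaugeConfig 3 L (Matrix.specialUnitaryGroup (Fin 2) ℂ)) :=
    wilsonMeasure (d := 3) (L := L) (fundamentalRep (Fin 2)) β' with hμ
  haveI : IsProbabilityMeasure μ :=
    isProbabilityMeasure_wilsonMeasure (d := 3) (L := L) (fundamentalRep (Fin 2)) (continuous_fundamentalRep (Fin 2)) β'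
  set φ : ℝ≥0 → ℝ := fun v => ∫ V, F' V * (∫ y, F' y ∂(κ v V)) ∂μ with hφ
  set φ₀ : ℝ := ∫ V, F' V * F' V ∂μ with hφ₀
  set d : ℝ := ∫ V, F' V * gen V ∂μ with hd
  have hφ₀pos : 0 < φ₀ := hF0
  have hFc : Continuous F' := hf.continuous.comp (continuous_coords (L := L))
  -- `κ_0 = δ`: `φ 0 = φ₀`
  have hκ0 : ∀ x, κ 0 x = Measure.dirac x := by
    intro x
    haveI := isProbabilityMeasure_piWiener (Edge 3 L × NoiseIdx 2)
    have hWc := isFlatBrownian_piWiener 3 L (NoiseIdx 2)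
    obtain ⟨U, hU0, hU⟩ := solution_from_start hWc β' x
    rw [hreal 0 x _ _ _ hWc U hU0 hU]
    have hU0' : U 0 = fun _ => x := funext hU0
    rw [hU0', Measure.map_const, measure_univ, one_smul]
  have hφ0 : φ 0 = φ₀ := integral_congr_ae (Eventually.of_forall fun x => by
    show F' x * (∫ y, F' y ∂(κ 0 x)) = F' x * F' x
    rw [hκ0 x, integral_dirac])
  show φ₀ * Real.exp ((t : ℝ) * d / φ₀) ≤ φ t
  rcases eq_or_ne t 0 with ht0 | ht0
  · rw [ht0, NNReal.coe_zero, zero_mul, zero_div, Real.exp_zero, mul_one, hφ0]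
  have htpos : (0 : ℝ) < t := by
    have : (0 : ℝ≥0) < t := pos_iff_ne_zero.2 ht0
    exact_mod_cast this
  -- the Dirichlet form of the semigroup: slope of `τ ↦ φ τ` at `0⁺`
  have hs : Tendsto (fun τ : ℝ => τ⁻¹ * ((∫ V, F' V * (∫ y, F' y ∂(κ τ.toNNReal V)) ∂μ) - φ₀)) (𝓝[>] 0) (𝓝 d) :=
    tendsto_dirichletForm_semigroup L β' κ hreal hf hfc
  -- the sequence `g n = φ(t/n)/φ₀ - 1` with `n g n → t d / φ₀`
  set g : ℕ → ℝ := fun n => (∫ V, F' V * (∫ y, F' y ∂(κ (((t : ℝ) / n).toNNReal) V)) ∂μ) / φ₀ - 1 with hg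
  have hgl : Tendsto (fun n : ℕ => (n : ℝ) * g n) atTop (𝓝 ((t : ℝ) * d / φ₀)) := by
    have hτ : Tendsto (fun n : ℕ => (t : ℝ) / n) atTop (𝓝[>] 0) := by
      refine tendsto_nhdsWithin_iff.2 ⟨tendsto_const_div_atTop_nhds_zero_nat (t : ℝ), ?_⟩
      filter_upwards [eventually_gt_atTop 0] with n hn
      exact div_pos htpos (Nat.cast_pos.2 hn)
    have h1 := (hs.comp hτ).const_mul ((t : ℝ) / φ₀)
    rw [show (t : ℝ) * d / φ₀ = (t : ℝ) / φ₀ * d by ring]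
    refine h1.congr' ?_
    filter_upwards [eventually_gt_atTop 0] with n hn
    have hn' : (n : ℝ) ≠ 0 := (Nat.cast_pos.2 hn).ne'
    simp only [Function.comp, hg]
    field_simp
    try ring
  have hlim := (Real.tendsto_one_add_pow_exp_of_tendsto hgl).comp
    (tendsto_pow_atTop_atTop_of_one_lt (by norm_num : (1 : ℕ) < 2))
  have hlim' : Tendsto (fun k : ℕ => φ₀ * (1 + g (2 ^ k)) ^ (2 ^ k)) atTop (𝓝 (φ₀ * Real.exp ((t : ℝ) * d / φ₀))) :=
    hlim.const_mul φ₀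
  -- the dyadic lower bounds
  have hk : ∀ k : ℕ, φ₀ * (1 + g (2 ^ k)) ^ (2 ^ k) ≤ φ t := by
    intro k
    have h := integral_mul_transition_ge_pow L β' κ hreal hFc hF0 k t
    have e : 1 + g (2 ^ k) = φ (t / 2 ^ k) / φ₀ := by
      have hc : (((t : ℝ) / ((2 ^ k : ℕ) : ℝ)).toNNReal) = t / 2 ^ k := by
        rw [Nat.cast_pow, Nat.cast_ofNat, show (t : ℝ) / (2 : ℝ) ^ k = ((t / 2 ^ k : ℝ≥0) : ℝ) by
          rw [NNReal.coe_div, NNReal.coe_pow]; norm_num, Real.toNNReal_coe]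
      simp only [hg, hc]
      ring
    rw [e]
    exact h
  exact le_of_tendsto' hlim' hk

end Summit.QuantumFields.YangMills.Theorems.ColdStartUniversality

end
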